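import Summits.CriticalPhenomena.SAWScalingLimit.Theorems.SAWLoopFugacityFlowAvoidanceLimitAnchorDefs

/-!
# Degrees, collision-free configurations and dimer configurations — helper file 2/5 of stub
`stub_determinantal` of line `symplectic-fermion-anchor` (crux `SAWLoopFugacityFlow.AvoidanceLimit`,
stmt-CriticalPhenomena-10649)

Bookkeeping for the tree's strictly dilute loop model (`DiluteLoopModel`, collision weight `w = 0`)
on a subgraph `H ≤ ℤ²`: the degree `deg_F(z) = #{e ∈ F : z ∈ e}` of a vertex in an edge set, the
collision-free admissible configurations `{F ∈ configs H S A | oscVerts S F = ∅}` characterised by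
degrees (`mem_cfConfigs_iff`: degree `1` on the sources `A`, `0` or `2` elsewhere in `S`), how they
change when one edge is removed or added (`erase_mem_cfConfigs`, `insert_mem_cfConfigs`), and the
corresponding facts for the dimer configurations `dimerConfigs` and the covered set `covered` of the
line's Defs file (`dimerConfigs_eq_sdiff`, `filter_notMem_covered`). Folklore; no definitions.
-/

noncomputable section

open scoped BigOperators Topology symmDiff
open Filter Finset
open Literature.Probability.RandomPlanarGeometry Literature.Probability.LatticeModels

namespace Summit.CriticalPhenomena.SAWScalingLimit.Theorems.AvoidanceLimit.Anchor

namespace DetExpansion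

-- Local notations only (NO auxiliary definitions): indicator `[u ∼ v]`, `K_Λ = 1 - xA`, degree,
-- collision-free configurations, weight `x^{|F|}(-2)^{loops}`, `Z_{⟨-2,0,x⟩}` — whichever occur below.
local notation "deg[" F ", " z "]" => Finset.card (Finset.filter (fun e => z ∈ e) F)
local notation "cfC[" H ", " S ", " A "]" =>
  Finset.filter (fun F => DiluteLoopModel.oscVerts S F = ∅) (DiluteLoopModel.configs H S A)
local notation "pf[" H ", " x ", " S ", " A "]" =>
  DiluteLoopModel.partitionFunction (⟨-2, 0, x⟩ : DiluteLoopModel ℝ) H S A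

/-! ## Degrees and collision-free configurations of the strictly dilute loop model -/

section Configs

open DiluteLoopModel SimpleGraph

variable {H : SimpleGraph (Site 2)} [H.LocallyFinite]

/-- `deg[F, z] = 0` iff no edge of `F` contains `z`. [folklore] -/
theorem deg_eq_zero_iff {F : Finset (Sym2 (Site 2))} {z : Site 2} : deg[F, z] = 0 ↔ ∀ e ∈ F, z ∉ e := by
  rw [card_eq_zero, filter_eq_empty_iff]

/-- Degree of an enlarged edge set. [folklore] -/
theorem deg_insert {F : Finset (Sym2 (Site 2))} {e : Sym2 (Site 2)} (he : e ∉ F) (z : Site 2) :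
    deg[insert e F, z] = deg[F, z] + if z ∈ e then 1 else 0 := by
  rw [filter_insert]
  split_ifs with hz
  · rw [card_insert_of_notMem fun h => he (mem_filter.1 h).1]
  · rfl

/-- Degree of a diminished edge set. [folklore] -/
theorem deg_erase {F : Finset (Sym2 (Site 2))} {e : Sym2 (Site 2)} (he : e ∈ F) (z : Site 2) :
    deg[F, z] = deg[F.erase e, z] + if z ∈ e then 1 else 0 := by
  conv_lhs => rw [← insert_erase he]
  exact deg_insert (notMem_erase e F) z

/-- Degree of a disjoint union. [folklore] -/
theorem deg_union {F₁ F₂ : Finset (Sym2 (Site 2))} (h : Disjoint F₁ F₂) (z : Site 2) :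
    deg[F₁ ∪ F₂, z] = deg[F₁, z] + deg[F₂, z] := by
  rw [filter_union, card_union_of_disjoint (disjoint_filter_filter h)]

/-- Degree is monotone. [folklore] -/
theorem deg_mono {F₁ F₂ : Finset (Sym2 (Site 2))} (h : F₁ ⊆ F₂) (z : Site 2) :
    deg[F₁, z] ≤ deg[F₂, z] :=
  card_le_card (filter_subset_filter _ h)

/-- At most one edge at `z`: any two edges of `F` at `z` coincide. [folklore] -/
theorem eq_of_deg_le_one {F : Finset (Sym2 (Site 2))} {z : Site 2} (h : deg[F, z] ≤ 1) {e e' : Sym2 (Site 2)}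
    (he : e ∈ F) (hz : z ∈ e) (he' : e' ∈ F) (hz' : z ∈ e') : e = e' :=
  Finset.card_le_one.1 h e (mem_filter.2 ⟨he, hz⟩) e' (mem_filter.2 ⟨he', hz'⟩)

/-- An edge set inside `edgesIn H S` with `H ≤ ℤ²` consists of lattice edges. [folklore] -/
theorem lattice_of_subset (hH : H ≤ zdGraph 2) {S : Finset (Site 2)} {F : Finset (Sym2 (Site 2))}
    (hF : F ⊆ edgesIn H S) : ∀ e ∈ F, e ∈ (zdGraph 2).edgeSet := fun _ he =>
  edgeSet_subset_edgeSet.2 hH (mem_edgesIn_iff.1 (hF he)).1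

/-- For lattice edge sets the tree's lattice degree `ldeg` is `deg`. [folklore] -/
theorem ldeg_eq_deg {F : Finset (Sym2 (Site 2))} (hF : ∀ e ∈ F, e ∈ (zdGraph 2).edgeSet) (z : Site 2) :
    ldeg F z = deg[F, z] :=
  ldeg_eq_card_filter hF z

/-- An edge of `F ⊆ edgesIn H S` at `z` is `s(z, u)` with `u ∼ z`, `u ∈ S`. [folklore] -/
theorem exists_adj_of_deg_ne_zero {S : Finset (Site 2)} {F : Finset (Sym2 (Site 2))} (hF : F ⊆ edgesIn H S)
    {z : Site 2} (h : deg[F, z] ≠ 0) : ∃ u, H.Adj z u ∧ u ∈ S ∧ s(z, u) ∈ F := by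
  obtain ⟨e, he, hze⟩ : ∃ e ∈ F, z ∈ e := by
    by_contra h'
    exact h (deg_eq_zero_iff.2 fun e he hze => h' ⟨e, he, hze⟩)
  obtain ⟨u, rfl⟩ := Sym2.mem_iff_exists.1 hze
  have h' := mem_edgesIn_iff.1 (hF he)
  exact ⟨u, h'.1, h'.2 u (Sym2.mem_mk_right _ _), he⟩

/-- The number of `u ∈ S` with `s(z, u) ∈ F` is the degree of `z` (for `F ⊆ edgesIn H S`). [folklore] -/
theorem card_filter_mk_mem_eq_deg {S : Finset (Site 2)} {F : Finset (Sym2 (Site 2))} (hF : F ⊆ edgesIn H S)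
    (z : Site 2) : #(S.filter fun u => s(z, u) ∈ F) = deg[F, z] := by
  refine card_bij (fun u _ => s(z, u)) (fun u hu => mem_filter.2 ⟨(mem_filter.1 hu).2, Sym2.mem_mk_left _ _⟩)
    (fun u hu u' hu' h => ?_) (fun e he => ?_)
  · rcases Sym2.eq_iff.1 h with ⟨-, h⟩ | ⟨h1, h2⟩
    · exact h
    · exact h2.trans h1
  · obtain ⟨he, hze⟩ := mem_filter.1 he
    obtain ⟨u, rfl⟩ := Sym2.mem_iff_exists.1 hze
    exact ⟨u, mem_filter.2 ⟨(mem_edgesIn_iff.1 (hF he)).2 u (Sym2.mem_mk_right _ _), he⟩, rfl⟩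

/-- **Membership in `cfConfigs` as a degree condition**: `F ⊆ ℰ_S`, `A ⊆ S`, degree `1` on `A` and
degree `0` or `2` on `S ∖ A`. [folklore] -/
theorem mem_cfConfigs_iff (hH : H ≤ zdGraph 2) {S A : Finset (Site 2)} {F : Finset (Sym2 (Site 2))} :
    F ∈ cfC[H, S, A] ↔ F ⊆ edgesIn H S ∧ A ⊆ S ∧
      ∀ z ∈ S, (z ∈ A → deg[F, z] = 1) ∧ (z ∉ A → deg[F, z] = 0 ∨ deg[F, z] = 2) := by
  rw [mem_filter, mem_configs]
  constructor
  · rintro ⟨⟨hsub, hA⟩, hosc⟩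
    have hlat := lattice_of_subset hH hsub
    have hle : ∀ z ∈ S, deg[F, z] ≤ 2 := fun z hz => by
      by_contra h
      have : z ∈ oscVerts S F := mem_oscVerts.2 ⟨hz, by rw [ldeg_eq_deg hlat]; omega⟩
      rw [hosc] at this
      exact notMem_empty _ this
    have hmemA : ∀ z, z ∈ A ↔ z ∈ S ∧ Odd (deg[F, z]) := fun z => by rw [← hA, mem_filter]
    refine ⟨hsub, fun z hz => ((hmemA z).1 hz).1, fun z hz => ⟨fun hzA => ?_, fun hzA => ?_⟩⟩
    · obtain ⟨k, hk⟩ := ((hmemA z).1 hzA).2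
      have := hle z hz
      omega
    · have hne : ¬Odd (deg[F, z]) := fun ho => hzA ((hmemA z).2 ⟨hz, ho⟩)
      rw [Nat.not_odd_iff_even] at hne
      obtain ⟨k, hk⟩ := hne
      have := hle z hz
      omega
  · rintro ⟨hsub, hAS, hdeg⟩
    have hlat := lattice_of_subset hH hsub
    refine ⟨⟨hsub, ?_⟩, ?_⟩
    · ext z
      rw [mem_filter]
      constructor
      · rintro ⟨hz, ho⟩
        by_contra hzA
        rcases (hdeg z hz).2 hzA with h0 | h2
        · rw [h0] at ho; exact absurd ho (by decide)
        · rw [h2] at ho; exact absurd ho (by decide)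
      · intro hzA
        refine ⟨hAS hzA, ?_⟩
        rw [(hdeg z (hAS hzA)).1 hzA]
        exact odd_one
    · rw [← Finset.not_nonempty_iff_eq_empty]
      rintro ⟨z, hz⟩
      rw [mem_oscVerts, ldeg_eq_deg hlat] at hz
      obtain ⟨h1, h2⟩ := hdeg z hz.1
      by_cases hzA : z ∈ A
      · have := h1 hzA; omega
      · rcases h2 hzA with h | h <;> omega

/-- Members of `cfConfigs` lie in `ℰ_S`. [folklore] -/
theorem subset_of_mem_cfConfigs {S A : Finset (Site 2)} {F : Finset (Sym2 (Site 2))}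
    (hF : F ∈ cfC[H, S, A]) : F ⊆ edgesIn H S :=
  (mem_configs.1 (mem_filter.1 hF).1).1

/-- Members of `cfConfigs` have degree `≤ 2` everywhere. [folklore] -/
theorem deg_le_two_of_mem_cfConfigs (hH : H ≤ zdGraph 2) {S A : Finset (Site 2)} {F : Finset (Sym2 (Site 2))}
    (hF : F ∈ cfC[H, S, A]) (z : Site 2) : deg[F, z] ≤ 2 := by
  obtain ⟨hsub, -, hdeg⟩ := (mem_cfConfigs_iff hH).1 hF
  by_cases hz : z ∈ S
  · obtain ⟨h1, h2⟩ := hdeg z hz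
    by_cases hzA : z ∈ A
    · rw [h1 hzA]; exact one_le_two
    · rcases h2 hzA with h | h <;> omega
  · rw [deg_eq_zero_iff.2 fun e he hze => hz ((mem_edgesIn_iff.1 (hsub he)).2 z hze)]
    exact zero_le_two

/-- **Removing an edge** `e ∈ F` from a collision-free configuration: the sources at the two
endpoints of `e` are toggled; the volume may be shrunk to any `S' ⊆ S` still containing the
remaining edges and the new sources. [folklore] -/
theorem erase_mem_cfConfigs (hH : H ≤ zdGraph 2) {S S' A A' : Finset (Site 2)} {F : Finset (Sym2 (Site 2))}
    {e : Sym2 (Site 2)} (hF : F ∈ cfC[H, S, A]) (he : e ∈ F) (hS' : S' ⊆ S) (hA'S' : A' ⊆ S')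
    (hend : ∀ e' ∈ F.erase e, ∀ z ∈ e', z ∈ S') (hA1 : ∀ z ∈ S', z ∉ e → (z ∈ A' ↔ z ∈ A))
    (hA2 : ∀ z ∈ S', z ∈ e → (z ∈ A' ↔ z ∉ A)) : F.erase e ∈ cfC[H, S', A'] := by
  obtain ⟨hsub, -, hdeg⟩ := (mem_cfConfigs_iff hH).1 hF
  refine (mem_cfConfigs_iff hH).2 ⟨fun e' he' => mem_edgesIn_iff.2
    ⟨(mem_edgesIn_iff.1 (hsub (mem_erase.1 he').2)).1, hend e' he'⟩, hA'S', fun z hz => ?_⟩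
  have hd := deg_erase he z
  obtain ⟨h1, h2⟩ := hdeg z (hS' hz)
  by_cases hze : z ∈ e
  · rw [if_pos hze] at hd
    have hiff := hA2 z hz hze
    by_cases hzA : z ∈ A
    · have := h1 hzA
      refine ⟨fun hzA' => absurd hzA (hiff.1 hzA'), fun _ => Or.inl (by omega)⟩
    · have hzA' := hiff.2 hzA
      have hpos : deg[F, z] ≠ 0 := fun h0 => (deg_eq_zero_iff.1 h0) e he hze
      refine ⟨fun _ => ?_, fun h => absurd hzA' h⟩
      rcases h2 hzA with h | h <;> omega
  · rw [if_neg hze, add_zero] at hd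
    have hiff := hA1 z hz hze
    rw [← hd]
    exact ⟨fun hzA' => h1 (hiff.1 hzA'), fun hzA' => h2 fun hzA => hzA' (hiff.2 hzA)⟩

/-- **Adding an edge** `s(p, q) ∉ F'` of `H` to a collision-free configuration on `S' ⊆ S`: each
endpoint must be a source of `F'` or outside `S'`; it stops / starts being a source. [folklore] -/
theorem insert_mem_cfConfigs (hH : H ≤ zdGraph 2) {S S' A A' : Finset (Site 2)} {F' : Finset (Sym2 (Site 2))}
    {p q : Site 2} (hF' : F' ∈ cfC[H, S', A']) (hpq : H.Adj p q) (hp : p ∈ S) (hq : q ∈ S)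
    (he : s(p, q) ∉ F') (hS' : S' ⊆ S) (hAS : A ⊆ S)
    (hout : ∀ z ∈ S, z ∉ S' → (z ∈ A ↔ z ∈ s(p, q)))
    (hin1 : ∀ z ∈ S', z ∉ s(p, q) → (z ∈ A ↔ z ∈ A'))
    (hin2 : ∀ z ∈ S', z ∈ s(p, q) → z ∈ A' ∧ z ∉ A) : insert s(p, q) F' ∈ cfC[H, S, A] := by
  obtain ⟨hsub, -, hdeg⟩ := (mem_cfConfigs_iff hH).1 hF'
  have hout0 : ∀ z, z ∉ S' → deg[F', z] = 0 := fun z hz =>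
    deg_eq_zero_iff.2 fun e' he' hze' => hz ((mem_edgesIn_iff.1 (hsub he')).2 z hze')
  refine (mem_cfConfigs_iff hH).2 ⟨?_, hAS, fun z hz => ?_⟩
  · intro e' he'
    rw [mem_insert] at he'
    rcases he' with rfl | he'
    · refine mem_edgesIn_iff.2 ⟨(mem_edgeSet H).2 hpq, fun z hz => ?_⟩
      rcases Sym2.mem_iff.1 hz with rfl | rfl
      · exact hp
      · exact hq
    · have := mem_edgesIn_iff.1 (hsub he')
      exact mem_edgesIn_iff.2 ⟨this.1, fun z hz => hS' (this.2 z hz)⟩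
  have hd := deg_insert he z
  by_cases hzS' : z ∈ S'
  · obtain ⟨h1, h2⟩ := hdeg z hzS'
    by_cases hze : z ∈ s(p, q)
    · rw [if_pos hze] at hd
      obtain ⟨hzA', hzA⟩ := hin2 z hzS' hze
      have := h1 hzA'
      exact ⟨fun h => absurd h hzA, fun _ => Or.inr (by omega)⟩
    · rw [if_neg hze, add_zero] at hd
      rw [hd]
      have hiff := hin1 z hzS' hze
      exact ⟨fun hzA => h1 (hiff.1 hzA), fun hzA => h2 fun hzA' => hzA (hiff.2 hzA')⟩
  · rw [hout0 z hzS', zero_add] at hd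
    have hiff := hout z hz hzS'
    by_cases hze : z ∈ s(p, q)
    · rw [if_pos hze] at hd
      exact ⟨fun _ => hd, fun h => absurd (hiff.2 hze) h⟩
    · rw [if_neg hze] at hd
      exact ⟨fun h => absurd (hiff.1 h) hze, fun _ => Or.inl hd⟩

end Configs

/-! ## Dimer configurations and the covered set -/

section DimerConfigs

open DiluteLoopModel SimpleGraph

variable {H : SimpleGraph (Site 2)} [H.LocallyFinite]

/-- Unfolding `covered`. [folklore] -/
theorem mem_covered {Λ : Finset (Site 2)} {M : Finset (Sym2 (Site 2))} {z : Site 2} :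
    z ∈ covered Λ M ↔ z ∈ Λ ∧ ∃ e ∈ M, z ∈ e := by
  simp only [covered, Finset.mem_filter]

/-- Unfolding `dimerConfigs`. [folklore] -/
theorem mem_dimerConfigs {Λ A : Finset (Site 2)} {M : Finset (Sym2 (Site 2))} :
    M ∈ dimerConfigs H Λ A ↔
      M ⊆ edgesIn H Λ ∧ (∀ v ∈ Λ, deg[M, v] ≤ 1) ∧ ∀ v ∈ A, ∀ e ∈ M, v ∉ e := by
  simp only [dimerConfigs, Finset.mem_filter, Finset.mem_powerset]

/-- The dressed partition function at `(n, t) = (-2, -1)`, unfolded. [folklore] -/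
theorem dimerPF_anchor_eq (x : ℝ) (Λ A : Finset (Site 2)) :
    dimerPF (-2 : ℝ) (-1) x H Λ A =
      ∑ M ∈ dimerConfigs H Λ A, (-1 * x ^ 2) ^ #M * pf[H, x, Λ \ covered Λ M, A] := rfl

/-- The covered set only depends on the volume through the edges' endpoints. [folklore] -/
theorem covered_eq_of_subset {Λ Λ' : Finset (Site 2)} {M : Finset (Sym2 (Site 2))}
    (hM : M ⊆ edgesIn H Λ') (hΛ : Λ' ⊆ Λ) : covered Λ M = covered Λ' M := by
  ext z
  rw [mem_covered, mem_covered]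
  exact ⟨fun ⟨_, e, he, hze⟩ => ⟨(mem_edgesIn_iff.1 (hM he)).2 z hze, e, he, hze⟩,
    fun ⟨hz, h⟩ => ⟨hΛ hz, h⟩⟩

/-- **Avoided sources = deleted vertices**: dimer configurations of `Λ` avoiding `A ⊆ Λ` are the
dimer configurations of `Λ ∖ A`. [folklore] -/
theorem dimerConfigs_eq_sdiff (Λ A : Finset (Site 2)) :
    dimerConfigs H Λ A = dimerConfigs H (Λ \ A) ∅ := by
  ext M
  rw [mem_dimerConfigs, mem_dimerConfigs]
  constructor
  · rintro ⟨hsub, hdeg, hav⟩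
    exact ⟨fun e he => mem_edgesIn_iff.2 ⟨(mem_edgesIn_iff.1 (hsub he)).1, fun z hz =>
      Finset.mem_sdiff.2 ⟨(mem_edgesIn_iff.1 (hsub he)).2 z hz, fun hzA => hav z hzA e he hz⟩⟩,
      fun v hv => hdeg v (Finset.mem_sdiff.1 hv).1, fun v hv => absurd hv (notMem_empty v)⟩
  · rintro ⟨hsub, hdeg, -⟩
    have hout : ∀ v ∈ A, ∀ e ∈ M, v ∉ e := fun v hv e he hve =>
      (Finset.mem_sdiff.1 ((mem_edgesIn_iff.1 (hsub he)).2 v hve)).2 hv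
    refine ⟨fun e he => mem_edgesIn_iff.2 ⟨(mem_edgesIn_iff.1 (hsub he)).1, fun z hz =>
      (Finset.mem_sdiff.1 ((mem_edgesIn_iff.1 (hsub he)).2 z hz)).1⟩, fun v hv => ?_, hout⟩
    by_cases hvA : v ∈ A
    · rw [deg_eq_zero_iff.2 (hout v hvA)]; exact zero_le_one
    · exact hdeg v (Finset.mem_sdiff.2 ⟨hv, hvA⟩)

/-- Dimer configurations not covering `v` are the dimer configurations of `Λ ∖ v`. [folklore] -/
theorem filter_notMem_covered {Λ : Finset (Site 2)} (v : Site 2) :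
    (dimerConfigs H Λ ∅).filter (fun M => v ∉ covered Λ M) = dimerConfigs H (Λ.erase v) ∅ := by
  ext M
  rw [Finset.mem_filter, mem_dimerConfigs, mem_dimerConfigs, mem_covered]
  constructor
  · rintro ⟨⟨hsub, hdeg, -⟩, hv⟩
    refine ⟨fun e he => mem_edgesIn_iff.2 ⟨(mem_edgesIn_iff.1 (hsub he)).1, fun z hz =>
      mem_erase.2 ⟨fun hzv => hv ⟨hzv ▸ (mem_edgesIn_iff.1 (hsub he)).2 z hz, e, he, hzv ▸ hz⟩,
        (mem_edgesIn_iff.1 (hsub he)).2 z hz⟩⟩,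
      fun z hz => hdeg z (mem_of_mem_erase hz), fun z hz => absurd hz (notMem_empty z)⟩
  · rintro ⟨hsub, hdeg, -⟩
    have hv : ∀ e ∈ M, v ∉ e := fun e he hve => (mem_erase.1 ((mem_edgesIn_iff.1 (hsub he)).2 v hve)).1 rfl
    refine ⟨⟨fun e he => mem_edgesIn_iff.2 ⟨(mem_edgesIn_iff.1 (hsub he)).1, fun z hz =>
      mem_of_mem_erase ((mem_edgesIn_iff.1 (hsub he)).2 z hz)⟩, fun z hz => ?_,
      fun z hz => absurd hz (notMem_empty z)⟩, fun ⟨_, e, he, hve⟩ => hv e he hve⟩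
    by_cases hzv : z = v
    · rw [deg_eq_zero_iff.2 (hzv ▸ hv)]; exact zero_le_one
    · exact hdeg z (mem_erase.2 ⟨hzv, hz⟩)

/-- `(Λ ∖ C) ∖ a = (Λ ∖ a) ∖ C`. [folklore] -/
theorem sdiff_erase_comm (Λ C : Finset (Site 2)) (a : Site 2) : (Λ \ C).erase a = Λ.erase a \ C := by
  ext z
  simp only [mem_erase, Finset.mem_sdiff]
  tauto

/-- `Λ ∖ ({a} ∆ {b}) = (Λ ∖ a) ∖ b` for `a ≠ b`. [folklore] -/
theorem sdiff_symmDiff_eq {Λ : Finset (Site 2)} {a b : Site 2} (hab : a ≠ b) :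
    Λ \ ({a} ∆ {b}) = (Λ.erase a).erase b := by
  ext z
  simp only [Finset.mem_sdiff, mem_symmDiff, mem_singleton, mem_erase]
  constructor
  · rintro ⟨hz, h⟩
    refine ⟨fun hzb => h (Or.inr ⟨hzb, fun hza => hab (hza.symm.trans hzb)⟩),
      fun hza => h (Or.inl ⟨hza, ?_⟩), hz⟩
    exact fun hzb => hab (hza.symm.trans hzb)
  · rintro ⟨hzb, hza, hz⟩
    exact ⟨hz, fun h => h.elim (fun h => hza h.1) fun h => hzb h.1⟩

/-- The volume left by the dimers, after deleting `a`. [folklore] -/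
theorem sdiff_covered_erase {Λ : Finset (Site 2)} {M : Finset (Sym2 (Site 2))} {a : Site 2}
    (hM : M ∈ dimerConfigs H (Λ.erase a) ∅) :
    (Λ \ covered Λ M).erase a = Λ.erase a \ covered (Λ.erase a) M := by
  rw [sdiff_erase_comm, covered_eq_of_subset (mem_dimerConfigs.1 hM).1 (erase_subset _ _)]

end DimerConfigs

end DetExpansion

/-- Registered sub-goal of this helper file (stub `stub_determinantal`, file 2/5): **avoided sources
are deleted vertices** for the dimer configurations of the line's Defs. [folklore] -/
theorem dimerConfigs_eq_dimerConfigs_sdiff :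
    ∀ (H : SimpleGraph (Site 2)) [H.LocallyFinite] (Λ A : Finset (Site 2)),
      dimerConfigs H Λ A = dimerConfigs H (Λ \ A) ∅ :=
  fun _ _ Λ A => DetExpansion.dimerConfigs_eq_sdiff Λ A

end Summit.CriticalPhenomena.SAWScalingLimit.Theorems.AvoidanceLimit.Anchor

end
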